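import Literature.Analysis.FluidPDE.BoundedWeakGalilean
import Literature.Analysis.FluidPDE.KNSSThm53OfWindow
import Literature.Analysis.FluidPDE.AncientMildWeak
import Literature.Analysis.FluidPDE.BlowupAncientSolution
import Literature.Analysis.FluidPDE.KNSSPoloidalAxisDecay
import HarnessLib

/-!
# KNSS 2009, Theorem 5.3 in a Galilean frame: `r |u − c e_z| ≤ C` forces `u ≡ c e_z`

Analysis/FluidPDE consequences file (all results proved, no definitions, no named facts).
Koch–Nadirashvili–Seregin–Šverák's Theorem 5.3 (Acta Math. 203 (2009) = arXiv:0709.3599, p. 10: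
"Let `u` be a bounded weak solution of the Navier–Stokes equations in `ℝ³ × (−∞, 0)`. Assume
that `u` is axi-symmetric and, in addition, satisfies `|u(x, t)| ≤ C / √(x₁² + x₂²)`. Then
`u = 0`.") is DISCHARGED in the tree for KNSS's bounded weak class
(`KNSS2009_liouville_bound_C_over_r_holds`, `KNSSThm53OfWindow`). Composing it with the
Galilean covariance of that class (`IsBoundedWeakNSSolutionOn.galileanBoost`,
`BoundedWeakGalilean`; Majda–Bertozzi 2002, Prop. 1.1 (i)) along the axis — an axial boost
`u ↦ u(t, y + t c e_z) − c e_z` preserves axisymmetry and the distance `r` to the axis — gives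
the **frame-optimised** form of the theorem:

* `KNSS2009_liouville_bound_C_over_r_galilean` (KNSS's weak class): an axisymmetric bounded weak
  solution on `ℝ³ × (−∞, 0)` with `r ‖u(t, x) − c e_z‖ ≤ C` (a.e.) is a.e. the constant axial
  stream `c e_z` on a.e. slice;
* `IsBoundedAncientMildSolution.eq_smul_eZ_of_cylRadius_mul_norm_sub_le` (the tree's duality-form
  class of bounded ancient mild solutions, for jointly continuous fields — the shape of the KNSS
  blow-up limits `IsKNSSBlowupLimit` of Proposition 6.1): the same conclusion EVERYWHERE on every
  slice `t < 0` (through the mild ⇒ weak bridge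
  `IsBoundedAncientMildSolution.isBoundedWeakNSSolutionOn` and continuity);
* for a KNSS blow-up limit (`|v| ≤ 1 = sup |v|`): the constant then has `|c| = 1`
  (`IsKNSSBlowupLimit.abs_eq_one_of_cylRadius_mul_norm_sub_le`), and the kill form used by the
  Type-II bookkeeping of blow-up scenarios: an axisymmetric inner object with ONE non-constant
  slice satisfies `sup r ‖v − c e_z‖ = ∞` for EVERY real `c`
  (`IsKNSSBlowupLimit.exists_lt_cylRadius_mul_norm_sub_smul_eZ`; dichotomy
  `IsKNSSBlowupLimit.eq_smul_eZ_or_exists_lt`). With `c = 0` these are Theorem 5.3 itself.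
* the same with the bound on the **poloidal (meridional) part** only, `r ‖ū − c e_z‖ ≤ C`, when
  the swirl `Γ = r u_θ` is bounded (Seregin–Šverák's form of the hypothesis; `r‖u − c e_z‖ ≤
  r‖ū − c e_z‖ + |Γ|`, `KNSSPoloidalAxisDecay`):
  `IsBoundedAncientMildSolution.eq_smul_eZ_of_cylRadius_mul_norm_poloidal_sub_le`,
  `IsKNSSBlowupLimit.exists_lt_cylRadius_mul_norm_poloidal_sub_smul_eZ` — "`inf_c sup r |(W^r,
  W^z − c)| = ∞`" for every axisymmetric inner object with bounded swirl and a non-constant slice.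

WHAT THIS IS NOT: no statement about Navier–Stokes regularity or blow-up; nothing here asserts
that a blow-up limit exists. It is Theorem 5.3 read in the inertial frames that preserve the
axis.

## Mathlib / tree search

Tree: `KNSS2009_liouville_bound_C_over_r(_holds)`, `ae_rotZ_of_isAxisymmetric`
(`KNSSLiouville`, `KNSSThm53OfWindow`), `IsBoundedAncientMildSolution.isBoundedWeakNSSolutionOn`
(`AncientMildWeak`), `IsKNSSBlowupLimit` (`BlowupAncientSolution`), `rotZ`/`eZ`/`cylRadius`
(`AxisymmetricEuler`; the axial-translation identities are re-proved privately here, cf.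
`cylRadius_add_smul_eZ` of `PeriodicCylinderSymmetry`, `rotZ_smul_eZ` of
`SereginSverakBlowupSelection`, not imported), `cylRadius_mul_norm_le_poloidal_add_abs_swirl`,
`poloidalPart_eq_sub_smul_rotGen` (`KNSSPoloidalAxisDecay`, `AxisymPoloidalPart`). Mathlib: `measurePreserving_add_right`,
`Measure.QuasiMeasurePreserving.ae_eq_comp`/`.ae`, `Continuous.ae_eq_iff_eq`,
`ContinuousOn.isOpen_inter_preimage`, `IsOpen.measure_pos`.

## References

* G. Koch, N. Nadirashvili, G. Seregin, V. Šverák, *Liouville theorems for the Navier–Stokes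
  equations and applications*, Acta Math. 203 (2009) 83–105 = arXiv:0709.3599, Thm 5.3
  (arXiv p. 10), Prop. 6.1 and (6.2)–(6.3) (arXiv p. 11). [KochNadirashviliSereginSverak2009]
* A. J. Majda, A. L. Bertozzi, *Vorticity and Incompressible Flow*, CUP 2002, §1.2,
  Prop. 1.1 (i), eq. (1.9), p. 3 (Galilean invariance). [MajdaBertozziCUP2002]
-/

noncomputable section

open MeasureTheory Set Function Filter Topology TopologicalSpace InnerProductSpace Measure
open scoped RealInnerProductSpace

namespace Literature.Analysis.FluidPDE

/-! ### Axial translations: they commute with the rotations and preserve the radius -/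

/-- `R_θ (x + s e_z) = R_θ x + s e_z` (the rotations fix the axis pointwise). [folklore] -/
private theorem rotZ_add_smul_eZ_aux (θ s : ℝ) (x : EuclideanSpace ℝ (Fin 3)) :
    rotZ θ (x + s • eZ) = rotZ θ x + s • eZ := by
  ext i
  fin_cases i <;> simp [rotZ, eZ]

/-- `R_θ (w − s e_z) = R_θ w − s e_z`. [folklore] -/
private theorem rotZ_sub_smul_eZ_aux (θ s : ℝ) (w : EuclideanSpace ℝ (Fin 3)) :
    rotZ θ (w - s • eZ) = rotZ θ w - s • eZ := by
  ext i
  fin_cases i <;> simp [rotZ, eZ]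

/-- The distance to the axis is invariant under axial translations. [folklore] -/
private theorem cylRadius_add_smul_eZ_aux (x : EuclideanSpace ℝ (Fin 3)) (s : ℝ) :
    cylRadius (x + s • eZ) = cylRadius x := by
  simp [cylRadius, eZ]

/-- `‖c e_z‖ = |c|`. [folklore] -/
private theorem norm_smul_eZ_aux (c : ℝ) : ‖c • (eZ : EuclideanSpace ℝ (Fin 3))‖ = |c| := by
  have h1 : ‖(eZ : EuclideanSpace ℝ (Fin 3))‖ = 1 := by
    simp [eZ]
  rw [norm_smul, Real.norm_eq_abs, h1, mul_one]

/-! ### Theorem 5.3 in a Galilean frame, KNSS's bounded weak class -/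

/-- **KNSS 2009, Theorem 5.3 in the frame moving along the axis with speed `c`.** Let `u` be a
bounded weak solution of Navier–Stokes (`ν = 1`) on `ℝ³ × (−∞, 0)` in the sense of
Koch–Nadirashvili–Seregin–Šverák, axisymmetric (a.e. form), and assume that for some real `c`
and `C`, `r ‖u(t, x) − c e_z‖ ≤ C` for a.e. `t < 0` and a.e. `x` (`r` the distance to the
axis). Then `u(t) = c e_z` a.e., for a.e. `t < 0`. Proof: the Galilean image
`v(t, y) = u(t, y + t c e_z) − c e_z` (Majda–Bertozzi, Prop. 1.1 (i)) is again a bounded weak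
solution (`IsBoundedWeakNSSolutionOn.galileanBoost`), axisymmetric because axial translations
commute with the rotations about the axis and `R_θ e_z = e_z`, and `r ‖v‖ ≤ C` because the
translations preserve `r`; Theorem 5.3 (`KNSS2009_liouville_bound_C_over_r_holds`) gives
`v = 0`, i.e. `u = c e_z`, slice by slice up to the measure-preserving translations. The case
`c = 0` is Theorem 5.3 itself. [cite: KochNadirashviliSereginSverak2009, Thm 5.3 (arXiv p. 10); MajdaBertozziCUP2002 §1.2 Prop. 1.1 (i) eq. (1.9)] -/
theorem KNSS2009_liouville_bound_C_over_r_galilean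
    {u : ℝ → EuclideanSpace ℝ (Fin 3) → EuclideanSpace ℝ (Fin 3)}
    (hu : IsBoundedWeakNSSolutionOn (Iio 0) isOpen_Iio 1 u)
    (hax : ∀ θ : ℝ, ∀ᵐ t ∂(volume.restrict (Iio (0 : ℝ))),
      (fun x => u t (rotZ θ x)) =ᵐ[volume] fun x => rotZ θ (u t x))
    (c : ℝ) (hC : ∃ C : ℝ, ∀ᵐ t ∂(volume.restrict (Iio (0 : ℝ))),
      ∀ᵐ x ∂(volume : Measure (EuclideanSpace ℝ (Fin 3))), cylRadius x * ‖u t x - c • eZ‖ ≤ C) :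
    ∀ᵐ t ∂(volume.restrict (Iio (0 : ℝ))), u t =ᵐ[volume] fun _ => c • eZ := by
  -- the Galilean image along the axis
  have hvw : IsBoundedWeakNSSolutionOn (Iio 0) isOpen_Iio 1
      (fun t y => u t (y + t • (c • eZ)) - c • eZ) := hu.galileanBoost (c • eZ)
  have hT : ∀ s : ℝ, QuasiMeasurePreserving
      (fun x : EuclideanSpace ℝ (Fin 3) => x + s • eZ) volume volume :=
    fun s => (measurePreserving_add_right volume (s • eZ)).quasiMeasurePreserving
  have hsm : ∀ t : ℝ, t • (c • (eZ : EuclideanSpace ℝ (Fin 3))) = (t * c) • eZ :=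
    fun t => smul_smul t c eZ
  -- axisymmetry of the image
  have hax' : ∀ θ : ℝ, ∀ᵐ t ∂(volume.restrict (Iio (0 : ℝ))),
      (fun x => u t (rotZ θ x + t • (c • eZ)) - c • eZ) =ᵐ[volume]
        fun x => rotZ θ (u t (x + t • (c • eZ)) - c • eZ) := by
    intro θ
    filter_upwards [hax θ] with t ht
    have h1 := (hT (t * c)).ae_eq_comp ht
    filter_upwards [h1] with x hx
    simp only [Function.comp_apply] at hx
    rw [hsm, ← rotZ_add_smul_eZ_aux, hx, rotZ_sub_smul_eZ_aux]
  -- the decay of the image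
  have hC' : ∃ C : ℝ, ∀ᵐ t ∂(volume.restrict (Iio (0 : ℝ))),
      ∀ᵐ x ∂(volume : Measure (EuclideanSpace ℝ (Fin 3))),
        cylRadius x * ‖u t (x + t • (c • eZ)) - c • eZ‖ ≤ C := by
    obtain ⟨C, hC⟩ := hC
    refine ⟨C, ?_⟩
    filter_upwards [hC] with t ht
    have h1 := (hT (t * c)).ae ht
    filter_upwards [h1] with x hx
    rw [hsm, ← cylRadius_add_smul_eZ_aux x (t * c)]
    exact hx
  -- Theorem 5.3 for the image, pulled back along the inverse translation
  have h53 := KNSS2009_liouville_bound_C_over_r_holds hvw hax' hC'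
  filter_upwards [h53] with t ht
  have hT' : QuasiMeasurePreserving
      (fun x : EuclideanSpace ℝ (Fin 3) => x - (t * c) • eZ) volume volume :=
    (measurePreserving_sub_right volume ((t * c) • eZ)).quasiMeasurePreserving
  have h1 := hT'.ae_eq_comp ht
  filter_upwards [h1] with x hx
  simp only [Function.comp_apply, Pi.zero_apply, hsm, sub_add_cancel] at hx
  exact sub_eq_zero.1 hx

/-! ### The duality-form class of bounded ancient mild solutions (continuous fields) -/

/-- **Theorem 5.3 in a Galilean frame for the tree's duality-form class, continuous fields.**
Let `v` be a bounded ancient mild solution (`ν = 1`; `IsBoundedAncientMildSolution`, the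
two-time duality class of `SelfSimilar`) which is jointly continuous on `(−∞, 0) × ℝ³`, with
axisymmetric slices, and assume `r ‖v(t, x) − c e_z‖ ≤ C` for all `t < 0` and all `x`. Then
`v(t, x) = c e_z` for ALL `t < 0`, `x`. (Mild ⇒ weak for jointly measurable fields,
`IsBoundedAncientMildSolution.isBoundedWeakNSSolutionOn`; then
`KNSS2009_liouville_bound_C_over_r_galilean`; the a.e. conclusion is upgraded by continuity: a
continuous slice a.e. equal to a constant is that constant, and the exceptional set of times is
an open null set, hence empty.) This is the shape in which the inner objects of KNSS's
Proposition 6.1 (`IsKNSSBlowupLimit`: smooth bounded ancient mild solutions) consume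
Theorem 5.3. [cite: KochNadirashviliSereginSverak2009, Thm 5.3 (arXiv p. 10); MajdaBertozziCUP2002 §1.2 Prop. 1.1 (i) eq. (1.9)] -/
theorem IsBoundedAncientMildSolution.eq_smul_eZ_of_cylRadius_mul_norm_sub_le
    {v : ℝ → EuclideanSpace ℝ (Fin 3) → EuclideanSpace ℝ (Fin 3)} (hv : IsBoundedAncientMildSolution 1 v)
    (hcont : ContinuousOn (uncurry v) (Iio 0 ×ˢ univ))
    (hax : ∀ t < 0, IsAxisymmetric (v t)) {c C : ℝ}
    (hC : ∀ t < 0, ∀ x, cylRadius x * ‖v t x - c • eZ‖ ≤ C) :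
    ∀ t < 0, ∀ x, v t x = c • eZ := by
  have hmeas : AEStronglyMeasurable (uncurry v)
      ((volume : Measure (ℝ × EuclideanSpace ℝ (Fin 3))).restrict (Iio 0 ×ˢ univ)) :=
    hcont.aestronglyMeasurable (measurableSet_Iio.prod MeasurableSet.univ)
  have hslc : ∀ t < 0, Continuous (v t) := fun t ht =>
    hcont.comp_continuous (continuous_const.prodMk continuous_id) fun x => ⟨ht, mem_univ _⟩
  have hw : IsBoundedWeakNSSolutionOn (Iio 0) isOpen_Iio 1 v :=
    hv.isBoundedWeakNSSolutionOn one_pos hmeas fun t ht => (hslc t ht).aestronglyMeasurable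
  have hae := KNSS2009_liouville_bound_C_over_r_galilean hw (ae_rotZ_of_isAxisymmetric hax) c
    ⟨C, by
      filter_upwards [ae_restrict_mem measurableSet_Iio] with t ht
      exact Eventually.of_forall (hC t ht)⟩
  -- continuity in `x`: a.e.-constant continuous slices are constant
  have hS : ∀ᵐ t ∂(volume.restrict (Iio (0 : ℝ))), v t = fun _ => c • eZ := by
    filter_upwards [hae, ae_restrict_mem measurableSet_Iio] with t ht ht0
    exact (Continuous.ae_eq_iff_eq volume (hslc t ht0) continuous_const).1 ht
  -- continuity in `t`: the exceptional set of times is open and null, hence empty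
  intro t₀ ht₀ x₀
  by_contra hne
  have hcx : ContinuousOn (fun t : ℝ => v t x₀) (Iio 0) :=
    hcont.comp (continuous_id.prodMk continuous_const).continuousOn fun t ht => ⟨ht, mem_univ _⟩
  have hopen : IsOpen (Iio (0 : ℝ) ∩ (fun t : ℝ => v t x₀) ⁻¹' {w | w ≠ c • eZ}) :=
    hcx.isOpen_inter_preimage isOpen_Iio isOpen_ne
  have hpos : 0 < volume (Iio (0 : ℝ) ∩ (fun t : ℝ => v t x₀) ⁻¹' {w | w ≠ c • eZ}) :=
    hopen.measure_pos volume ⟨t₀, ht₀, hne⟩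
  have hzero : volume (Iio (0 : ℝ) ∩ (fun t : ℝ => v t x₀) ⁻¹' {w | w ≠ c • eZ}) = 0 := by
    rw [ae_restrict_iff' measurableSet_Iio, ae_iff] at hS
    refine measure_mono_null (fun t ht => ?_) hS
    simp only [mem_setOf_eq, Classical.not_imp]
    exact ⟨ht.1, fun h => ht.2 (congrFun h x₀)⟩
  exact hpos.ne' hzero

/-! ### KNSS blow-up limits (Proposition 6.1): the frame-optimised kill form -/

variable {v : ℝ → EuclideanSpace ℝ (Fin 3) → EuclideanSpace ℝ (Fin 3)}

/-- **Theorem 5.3 in a Galilean frame for a KNSS blow-up limit** (`IsKNSSBlowupLimit`: the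
smooth bounded ancient mild solution with `|v| ≤ 1 = sup |v|` produced from a finite-time
singularity by KNSS's Proposition 6.1): if the slices are axisymmetric and
`r ‖v(t, x) − c e_z‖ ≤ C` on `(−∞, 0) × ℝ³`, then `v ≡ c e_z`. [cite: KochNadirashviliSereginSverak2009, Thm 5.3 (arXiv p. 10) with Prop. 6.1 (arXiv p. 11); MajdaBertozziCUP2002 §1.2 Prop. 1.1 (i)] -/
theorem IsKNSSBlowupLimit.eq_smul_eZ_of_cylRadius_mul_norm_sub_le (h : IsKNSSBlowupLimit v)
    (hax : ∀ t < 0, IsAxisymmetric (v t)) {c C : ℝ}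
    (hC : ∀ t < 0, ∀ x, cylRadius x * ‖v t x - c • eZ‖ ≤ C) :
    ∀ t < 0, ∀ x, v t x = c • eZ :=
  h.isBoundedAncientMildSolution.eq_smul_eZ_of_cylRadius_mul_norm_sub_le h.smooth.continuousOn
    hax hC

/-- For a KNSS blow-up limit the axial stream forced by `r ‖v − c e_z‖ ≤ C` has speed
`|c| = 1` (`|v| ≤ 1` gives `|c| ≤ 1`, `sup |v| = 1` gives `|c| ≥ 1`). [cite: KochNadirashviliSereginSverak2009, Thm 5.3 (arXiv p. 10) with (6.3) (arXiv p. 11)] -/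
theorem IsKNSSBlowupLimit.abs_eq_one_of_cylRadius_mul_norm_sub_le (h : IsKNSSBlowupLimit v)
    (hax : ∀ t < 0, IsAxisymmetric (v t)) {c C : ℝ}
    (hC : ∀ t < 0, ∀ x, cylRadius x * ‖v t x - c • eZ‖ ≤ C) : |c| = 1 := by
  have hconst := h.eq_smul_eZ_of_cylRadius_mul_norm_sub_le hax hC
  obtain ⟨t₁, ht₁, x₁, -⟩ := h.exists_lt_norm 1 one_pos
  have hle : |c| ≤ 1 := by
    have := h.norm_le_one t₁ ht₁ x₁
    rwa [hconst t₁ ht₁ x₁, norm_smul_eZ_aux] at this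
  refine le_antisymm hle ?_
  by_contra hlt
  push Not at hlt
  obtain ⟨t, ht, x, hx⟩ := h.exists_lt_norm (1 - |c|) (by linarith)
  rw [hconst t ht x, norm_smul_eZ_aux] at hx
  linarith

/-- **The frame-optimised kill form.** A KNSS blow-up limit with axisymmetric slices and ONE
non-constant slice violates `r ‖v − c e_z‖ ≤ C` for EVERY real `c` and every `C`: for all
`c, C` there are `t < 0` and `x` with `C < r(x) ‖v(t, x) − c e_z‖` (no inertial frame along the
axis makes the field `O(1/r)`; `c = 0` is the plain consequence of Theorem 5.3). [cite: KochNadirashviliSereginSverak2009, Thm 5.3 (arXiv p. 10) with Prop. 6.1 (arXiv p. 11); MajdaBertozziCUP2002 §1.2 Prop. 1.1 (i)] -/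
theorem IsKNSSBlowupLimit.exists_lt_cylRadius_mul_norm_sub_smul_eZ (h : IsKNSSBlowupLimit v)
    (hax : ∀ t < 0, IsAxisymmetric (v t)) (hnc : ∃ t < 0, ∃ x y, v t x ≠ v t y) (c C : ℝ) :
    ∃ t < 0, ∃ x, C < cylRadius x * ‖v t x - c • eZ‖ := by
  by_contra hcon
  push Not at hcon
  have hconst := h.eq_smul_eZ_of_cylRadius_mul_norm_sub_le hax hcon
  obtain ⟨t, ht, x, y, hxy⟩ := hnc
  exact hxy (by rw [hconst t ht x, hconst t ht y])

/-- **Dichotomy for every axisymmetric KNSS blow-up limit** (constant slices included): for each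
real `c` and each `C`, either `v` is identically the axial stream `c e_z` (and then `|c| = 1`,
`IsKNSSBlowupLimit.abs_eq_one_of_cylRadius_mul_norm_sub_le`), or `r ‖v − c e_z‖` exceeds `C`
somewhere on `(−∞, 0) × ℝ³`. [cite: KochNadirashviliSereginSverak2009, Thm 5.3 (arXiv p. 10) with Prop. 6.1 (arXiv p. 11); MajdaBertozziCUP2002 §1.2 Prop. 1.1 (i)] -/
theorem IsKNSSBlowupLimit.eq_smul_eZ_or_exists_lt (h : IsKNSSBlowupLimit v)
    (hax : ∀ t < 0, IsAxisymmetric (v t)) (c C : ℝ) :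
    (∀ t < 0, ∀ x, v t x = c • eZ) ∨ ∃ t < 0, ∃ x, C < cylRadius x * ‖v t x - c • eZ‖ := by
  by_cases hcon : ∀ t < 0, ∀ x, cylRadius x * ‖v t x - c • eZ‖ ≤ C
  · exact Or.inl (h.eq_smul_eZ_of_cylRadius_mul_norm_sub_le hax hcon)
  · push Not at hcon
    exact Or.inr hcon

/-! ### The bound on the poloidal part only (bounded swirl) -/

/-- Subtracting an axial constant does not change the swirl `Γ = x₀u₁ − x₁u₀`. [folklore] -/
private theorem swirl_sub_smul_eZ_aux (u : EuclideanSpace ℝ (Fin 3) → EuclideanSpace ℝ (Fin 3))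
    (c : ℝ) (y : EuclideanSpace ℝ (Fin 3)) : swirl (fun y => u y - c • eZ) y = swirl u y := by
  simp [swirl, eZ]

/-- Subtracting an axial constant commutes with taking the poloidal part. [folklore] -/
private theorem poloidalPart_sub_smul_eZ_aux
    (u : EuclideanSpace ℝ (Fin 3) → EuclideanSpace ℝ (Fin 3)) (c : ℝ)
    (y : EuclideanSpace ℝ (Fin 3)) :
    poloidalPart (fun y => u y - c • eZ) y = poloidalPart u y - c • eZ := by
  rw [poloidalPart_eq_sub_smul_rotGen, poloidalPart_eq_sub_smul_rotGen, swirl_sub_smul_eZ_aux]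
  abel

/-- **Theorem 5.3 in a Galilean frame, bound on the poloidal part** (Seregin–Šverák's form of the
hypothesis, Comm. PDE 34 (2009) (1.2): the scale-invariant bound on the meridional part
`ū = u_r e_r + u_z e_z` only, the swirl `Γ = r u_θ` being bounded). A jointly continuous bounded
ancient mild solution (`ν = 1`) with axisymmetric slices, `|Γ| ≤ M` and
`r ‖ū(t, x) − c e_z‖ ≤ C` on `(−∞, 0) × ℝ³` is the constant `c e_z` (indeed
`r‖u − c e_z‖ ≤ r‖ū − c e_z‖ + |Γ| ≤ C + M`, since `u − c e_z` has poloidal part `ū − c e_z` and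
swirl `Γ`; then `eq_smul_eZ_of_cylRadius_mul_norm_sub_le`). [cite: KochNadirashviliSereginSverak2009, Thm 5.3 (arXiv p. 10); SereginSverak2009 §1 (1.2) p. 2; MajdaBertozziCUP2002 §1.2 Prop. 1.1 (i)] -/
theorem IsBoundedAncientMildSolution.eq_smul_eZ_of_cylRadius_mul_norm_poloidal_sub_le
    {v : ℝ → EuclideanSpace ℝ (Fin 3) → EuclideanSpace ℝ (Fin 3)}
    (hv : IsBoundedAncientMildSolution 1 v) (hcont : ContinuousOn (uncurry v) (Iio 0 ×ˢ univ))
    (hax : ∀ t < 0, IsAxisymmetric (v t)) (hsw : ∃ M : ℝ, ∀ t < 0, ∀ x, |swirl (v t) x| ≤ M)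
    {c C : ℝ} (hC : ∀ t < 0, ∀ x, cylRadius x * ‖poloidalPart (v t) x - c • eZ‖ ≤ C) :
    ∀ t < 0, ∀ x, v t x = c • eZ := by
  obtain ⟨M, hM⟩ := hsw
  refine hv.eq_smul_eZ_of_cylRadius_mul_norm_sub_le hcont hax (C := C + M) fun t ht x => ?_
  have h1 := cylRadius_mul_norm_le_of_poloidal_of_swirl (u := fun y => v t y - c • eZ)
    (C := C) (M := M) (fun y => ?_) (fun y => ?_) x
  · exact h1
  · rw [poloidalPart_sub_smul_eZ_aux]
    exact hC t ht y
  · rw [swirl_sub_smul_eZ_aux]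
    exact hM t ht y

/-- **The frame-optimised kill form on the poloidal part** ("`inf_c sup r |(W^r, W^z − c)| = ∞`"):
a KNSS blow-up limit with axisymmetric slices, bounded swirl and ONE non-constant slice violates
`r ‖W̄ − c e_z‖ ≤ C` for every real `c` and every `C`. [cite: KochNadirashviliSereginSverak2009, Thm 5.3 (arXiv p. 10) with Prop. 6.1 (arXiv p. 11); SereginSverak2009 §1 (1.2) p. 2; MajdaBertozziCUP2002 §1.2 Prop. 1.1 (i)] -/
theorem IsKNSSBlowupLimit.exists_lt_cylRadius_mul_norm_poloidal_sub_smul_eZ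
    (h : IsKNSSBlowupLimit v) (hax : ∀ t < 0, IsAxisymmetric (v t))
    (hsw : ∃ M : ℝ, ∀ t < 0, ∀ x, |swirl (v t) x| ≤ M) (hnc : ∃ t < 0, ∃ x y, v t x ≠ v t y)
    (c C : ℝ) : ∃ t < 0, ∃ x, C < cylRadius x * ‖poloidalPart (v t) x - c • eZ‖ := by
  by_contra hcon
  push Not at hcon
  have hconst := h.isBoundedAncientMildSolution.eq_smul_eZ_of_cylRadius_mul_norm_poloidal_sub_le
    h.smooth.continuousOn hax hsw hcon
  obtain ⟨t, ht, x, y, hxy⟩ := hnc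
  exact hxy (by rw [hconst t ht x, hconst t ht y])

end Literature.Analysis.FluidPDE

end
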